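import Summits.ABC.IUTFork.Joshi.GeometricCaseCoverModel
import Summits.ABC.IUTFork.Joshi.GeometricCaseBridge
import HarnessLib

/-!
# [J-III] §12.13–12.15 over the model of `S̃L₂(ℝ)`: a DISPLACEMENT HEIGHT satisfying (12.14.1) AND (12.15.1)

Block E of the abc-iut cell (rung LADDER-ABC:A2.E), seat abc-iut-E-t53 (batch 3; sequel to `Joshi/GeometricCaseCoverModel.lean`
p433554 and `…CoverModelHeight.lean`). PROOF/MODEL file over the automorphy-factor model `coverModel : CoverSL2R CoverModel.Cover` of
the universal cover ((12.3.1) PROVED there) and E-t36's bridge `GeoLocus.HeightDatum.ofCover` (`Joshi/GeometricCaseBridge.lean`, BY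
NAME). No claim-`Prop`, no `Prop` fact, no instance, no `sorry`; standard axioms.

SOURCE. K. Joshi, arXiv:2401.13508**v4** (unrefereed; bib `Joshi2024ATS3`): §12.13 p.154 l.1–10 «Let `h : S̃L₂(ℝ) → ℝ` be the function
defined in [Zhang, 2001, Proof of Theorem 3.3] (also defined in [Amorós et al., 2000]) … the stabilized logarithmic height function»;
§12.14 (12.14.1) p.154 l.13–14 «`h(g̃₁·g̃₂) ≤ h(g̃₁) + h(g̃₂)`»; §12.15 (12.15.1) p.155 l.18–21 «`h(g̃′_{τ,0}) = h(g̃_{τ,0}·φ_∞^m) ≤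
h(g̃_{τ,0}) + π·m ∈ ℝ`». E-t36 (`Joshi/GeometricCase2.lean`, p430006) keeps `h` a FIELD of `GeoLocus.HeightDatum` and types (12.14.1),
(12.15.1) as the hypothesis-`Prop`s `HeightSubadditive`, `HeightLogLinkBound` (claim-tagged, never asserted).

CONTENT (model level; [folklore]). On the model, an element `x = (g, T_{g,φ})` carries ITS logarithm `φ = logOf x` (read off the
translation part: `φ τ = (T (τ, 0)).2`), and `φ = log ∘ j(g,·) + 2πin` for a constant `n ∈ ℤ` (`exists_int_logOf_eq`), so `Im φ` is
bounded above by `π + 2πn`. The **displacement height** `height x := ½ · sup_τ Im (logOf x τ)` — half the maximal rotation of the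
logarithm, the shape of the translation-length functions of [Amorós et al. 2000] / [Zhang 2001] on the universal cover (we do NOT
claim it is literally Zhang's `ℓ`; print gives `h` only by citation) — satisfies, BY PROOF:
* (12.14.1) `height (x * y) ≤ height x + height y` (`height_mul_le`; from `logOf (x*y) τ = logOf x (g_y•τ) + logOf y τ`);
* (12.15.1) `height (x * φ_∞^m) ≤ height x + π·m` for ALL `m : ℤ` (`height_mul_phi_zpow_le`; in fact `φ_∞ = (1, T_{1,2πi})`
  shifts every logarithm by `2πi`), with `height 1 = 0`, `height z = π/2`, `height φ_∞ = π` (`height_phi`: the slope `π` of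
  (12.15.1) is attained);
* hence `displacementHeightDatum L := HeightDatum.ofCover coverModel L height` satisfies BOTH of E-t36's hypothesis-`Prop`s
  (`heightSubadditive_displacement`, `heightLogLinkBound_displacement`) — the typed hypothesis set of §12.14–12.15 is JOINTLY
  SATISFIABLE on an honest `S̃L₂(ℝ)`-model by a non-trivial height (the zero height fails (12.15.1):
  `not_heightLogLinkBound_zero` in `…CoverModelHeight.lean`), and E-t36's derived Thm. 12.18.1 reading applies to it
  (`thm12181Reading_displacement`). A satisfiability witness for the X-04-GEO row (cx-2), nothing more.
FRAMING: no side is taken on [IUTchIII] Cor. 3.12, on Joshi's claims or on any author; typed ≠ proved ≠ endorsed; nothing here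
bears on abc.
-/

noncomputable section

open Complex
open scoped MatrixGroups UpperHalfPlane Real

namespace Summit.ABC.IUTFork.Joshi.ATS3.Geo

namespace CoverModel

/-! ## 1. The logarithm carried by an element of the model -/

/-- The logarithm `φ` of `x = (g, T_{g,φ})`, read off the translation part: `φ τ = (T (τ, 0)).2`. [folklore] -/
def logOf (x : Cover) (τ : ℍ) : ℂ := ((x : SL(2, ℝ) × Equiv.Perm (ℍ × ℂ)).2 (τ, 0)).2

/-- `logOf x` is a continuous logarithm of `j(g, ·)` and `x = (g, T_{g, logOf x})`. [folklore] -/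
theorem logOf_spec (x : Cover) :
    IsLog x.1.1 (logOf x) ∧ (x : SL(2, ℝ) × Equiv.Perm (ℍ × ℂ)).2 = liftPerm x.1.1 (logOf x) := by
  obtain ⟨⟨g, P⟩, φ, hφ, hP⟩ := x
  simp only at hP
  subst hP
  have e : logOf ⟨(g, liftPerm g φ), φ, hφ, rfl⟩ = φ := funext fun τ => by simp [logOf]
  rw [e]
  exact ⟨hφ, rfl⟩

/-- `logOf` of an element given by data `(g, φ)` is `φ`. -/
@[simp] theorem logOf_mkElt (g : SL(2, ℝ)) (φ : ℍ → ℂ) (h : IsLog g φ) : logOf (mkElt g φ h) = φ :=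
  funext fun τ => by simp [logOf, mkElt]

/-- The translation part of `x` acts by `(τ, w) ↦ (g•τ, w + logOf x τ)`. [folklore] -/
theorem coe_snd_apply (x : Cover) (τ : ℍ) (w : ℂ) :
    (x : SL(2, ℝ) × Equiv.Perm (ℍ × ℂ)).2 (τ, w) = (x.1.1 • τ, w + logOf x τ) := by
  rw [(logOf_spec x).2]; rfl

/-- The logarithm of a product: `logOf (x*y) τ = logOf x (g_y • τ) + logOf y τ` (the cocycle law of the model). [folklore] -/
theorem logOf_mul (x y : Cover) (τ : ℍ) : logOf (x * y) τ = logOf x (y.1.1 • τ) + logOf y τ := by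
  change (((x * y : Cover) : SL(2, ℝ) × Equiv.Perm (ℍ × ℂ)).2 (τ, 0)).2 = _
  rw [Subgroup.coe_mul, Prod.snd_mul, Equiv.Perm.mul_apply, coe_snd_apply y, coe_snd_apply x]
  change 0 + logOf y τ + logOf x (y.1.1 • τ) = _
  rw [zero_add, add_comm]

/-- Every logarithm on the model is the principal logarithm of `j(g, ·)` plus a constant `2πin`. [folklore] -/
theorem exists_int_logOf_eq (x : Cover) : ∃ n : ℤ, ∀ τ : ℍ, logOf x τ = log (jAut x.1.1 τ) + n * (2 * π * I) := by
  set g := x.1.1 with hg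
  have hlog : IsLog g (fun τ => log (jAut g τ)) := by
    refine ⟨?_, fun τ => exp_log (jAut_ne_zero g τ)⟩
    by_cases hc : g 1 0 = 0
    · have e : (fun τ : ℍ => log (jAut g τ)) = fun _ => log (g 1 1 : ℂ) := funext fun τ => by
        simp [jAut, hc]
      rw [e]; exact continuous_const
    · refine Continuous.clog ?_ fun τ => ?_
      · exact (continuous_const.mul UpperHalfPlane.continuous_coe).add continuous_const
      · rw [mem_slitPlane_iff]; refine Or.inr ?_
        rw [jAut, add_im, mul_im, ofReal_re, ofReal_im, ofReal_im, zero_mul, add_zero, add_zero, UpperHalfPlane.coe_im]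
        exact mul_ne_zero hc τ.im_ne_zero
  obtain ⟨n, hn⟩ := Complex.exp_eq_one_iff.mp (by
    rw [exp_sub, (logOf_spec x).1.exp_eq, hlog.exp_eq, div_self (jAut_ne_zero g _)] :
      exp (logOf x UpperHalfPlane.I - log (jAut g UpperHalfPlane.I)) = 1)
  refine ⟨n, fun τ => ?_⟩
  have h : logOf x τ - log (jAut g τ) = logOf x UpperHalfPlane.I - log (jAut g UpperHalfPlane.I) :=
    (logOf_spec x).1.sub_eq_sub hlog τ UpperHalfPlane.I
  rw [hn] at h
  linear_combination h

/-- The imaginary part of a logarithm on the model is bounded above. [folklore] -/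
theorem bddAbove_range_im_logOf (x : Cover) : BddAbove (Set.range fun τ : ℍ => (logOf x τ).im) := by
  obtain ⟨n, hn⟩ := exists_int_logOf_eq x
  refine ⟨π + n * (2 * π), ?_⟩
  rintro _ ⟨τ, rfl⟩
  simp only [hn τ, add_im]
  have h1 := log_im_le_pi (jAut x.1.1 τ)
  have h2 : ((n : ℂ) * (2 * π * I)).im = n * (2 * π) := by simp
  rw [h2]
  linarith

/-! ## 2. The displacement height -/

/-- **The displacement height** on the model: `height x = ½ · sup_τ Im (logOf x τ)` — half the supremal rotation of the logarithm
of the automorphy factor (the shape of the translation-length functions on the universal cover in [Amorós et al. 2000],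
[Zhang 2001]; NOT claimed to be literally Zhang's `ℓ`). [folklore] -/
def height (x : Cover) : ℝ := sSup (Set.range fun τ : ℍ => (logOf x τ).im) / 2

/-- Each rotation is at most twice the height. [folklore] -/
theorem im_logOf_le (x : Cover) (τ : ℍ) : (logOf x τ).im ≤ 2 * height x := by
  have h := le_csSup (bddAbove_range_im_logOf x) (Set.mem_range_self (f := fun τ : ℍ => (logOf x τ).im) τ)
  unfold height
  linarith

/-- A uniform bound on the rotations bounds the height. [folklore] -/
theorem height_le_of_forall_le (x : Cover) {B : ℝ} (h : ∀ τ : ℍ, (logOf x τ).im ≤ B) : height x ≤ B / 2 := by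
  have hs : sSup (Set.range fun τ : ℍ => (logOf x τ).im) ≤ B :=
    csSup_le (Set.range_nonempty _) (by rintro _ ⟨τ, rfl⟩; exact h τ)
  unfold height
  linarith

/-- **(12.14.1) on the model**: the displacement height is SUBADDITIVE. [folklore] -/
theorem height_mul_le (x y : Cover) : height (x * y) ≤ height x + height y := by
  have h : height (x * y) ≤ (2 * height x + 2 * height y) / 2 :=
    height_le_of_forall_le _ fun τ => by
      rw [logOf_mul, add_im]
      exact add_le_add (im_logOf_le x _) (im_logOf_le y τ)
  linarith

/-- A constant logarithm `c` gives height `Im c / 2`. [folklore] -/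
theorem height_eq_of_logOf_const (x : Cover) (c : ℂ) (h : ∀ τ, logOf x τ = c) : height x = c.im / 2 := by
  unfold height
  have e : (Set.range fun τ : ℍ => (logOf x τ).im) = {c.im} := by
    ext r; simp only [Set.mem_range, Set.mem_singleton_iff, h]
    exact ⟨fun ⟨_, hr⟩ => hr.symm, fun hr => ⟨UpperHalfPlane.I, hr.symm⟩⟩
  rw [e, csSup_singleton]

/-- The logarithm of `1` is `0`. -/
theorem logOf_one (τ : ℍ) : logOf 1 τ = 0 := by
  simp [logOf]

/-- `height 1 = 0`. -/
theorem height_one : height 1 = 0 := by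
  rw [height_eq_of_logOf_const 1 0 logOf_one]; simp

/-- `height z = π/2` (the logarithm of `z` is the constant `iπ`). -/
theorem height_z : height z = π / 2 := by
  rw [height_eq_of_logOf_const z (π * I) fun τ => by rw [z, logOf_mkElt]]
  simp

/-- The logarithm of `z^n` is the constant `inπ`. -/
theorem logOf_z_zpow (n : ℤ) (τ : ℍ) : logOf (z ^ n) τ = n * (π * I) := by
  unfold logOf
  rw [coe_z_zpow]
  simp

/-- `height (z^n) = nπ/2`: the height is unbounded and detects the centre `⟨z⟩`. -/
theorem height_z_zpow (n : ℤ) : height (z ^ n) = n * π / 2 := by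
  rw [height_eq_of_logOf_const _ _ (logOf_z_zpow n)]
  simp

/-- Multiplying by `z^n` shifts every logarithm by `inπ`. [folklore] -/
theorem logOf_mul_z_zpow (x : Cover) (n : ℤ) (τ : ℍ) : logOf (x * z ^ n) τ = logOf x τ + n * (π * I) := by
  rw [logOf_mul, logOf_z_zpow]
  congr 2
  have h1 : ((z ^ n : Cover) : SL(2, ℝ) × Equiv.Perm (ℍ × ℂ)).1 = (-1) ^ n := by rw [coe_z_zpow]
  rw [h1]
  rcases Int.even_or_odd n with ⟨k, rfl⟩ | ⟨k, rfl⟩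
  · rw [← two_mul, neg_one_zpow_two_mul, one_smul]
  · rw [neg_one_zpow_two_mul_add_one, neg_smul_eq, one_smul]

/-- `height (x · z^n) ≤ height x + nπ/2`. [folklore] -/
theorem height_mul_z_zpow_le (x : Cover) (n : ℤ) : height (x * z ^ n) ≤ height x + n * π / 2 := by
  have h : height (x * z ^ n) ≤ (2 * height x + n * π) / 2 :=
    height_le_of_forall_le _ fun τ => by
      rw [logOf_mul_z_zpow, add_im]
      have h2 : ((n : ℂ) * (π * I)).im = n * π := by simp
      rw [h2]
      exact add_le_add (im_logOf_le x τ) le_rfl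
  linarith

/-- `height (x · z^n) = height x + nπ/2` (apply the inequality to `x·z^n` and `z^{-n}` for the reverse bound). [folklore] -/
theorem height_mul_z_zpow (x : Cover) (n : ℤ) : height (x * z ^ n) = height x + n * π / 2 := by
  refine le_antisymm (height_mul_z_zpow_le x n) ?_
  have h := height_mul_z_zpow_le (x * z ^ n) (-n)
  rw [mul_assoc, ← zpow_add, add_neg_cancel, zpow_zero, mul_one] at h
  push_cast at h
  linarith

/-- `φ_∞ = z²` (as an integer power). -/
theorem phi_eq_zpow_two : coverModel.phi = z ^ (2 : ℤ) := by
  rw [CoverSL2R.phi, zpow_two, pow_two]; rfl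

/-- `φ_∞^m = z^{2m}`. -/
theorem phi_zpow (m : ℤ) : coverModel.phi ^ m = z ^ (2 * m) := by
  rw [phi_eq_zpow_two, ← zpow_mul]

/-- **(12.15.1) on the model, with EQUALITY**: `height (x · φ_∞^m) = height x + π·m` for every `m : ℤ` (each log-link shifts every
logarithm by `2πi`). [folklore] -/
theorem height_mul_phi_zpow (x : Cover) (m : ℤ) : height (x * coverModel.phi ^ m) = height x + π * m := by
  rw [phi_zpow, height_mul_z_zpow]; push_cast; ring

/-- `height φ_∞ = π`: the slope `π` of (12.15.1) is attained. -/
theorem height_phi : height coverModel.phi = π := by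
  have h := height_mul_phi_zpow 1 1
  rw [one_mul, zpow_one, height_one] at h
  rw [h]; push_cast; ring

/-! ## 3. E-t36's hypothesis-`Prop`s (12.14.1) and (12.15.1) HOLD for the displacement height -/

/-- E-t36's §§12.9–12.18 signature over the model with the DISPLACEMENT height (via E-t36's bridge `HeightDatum.ofCover`). [folklore] -/
def displacementHeightDatum (L : Level) : GeoLocus.HeightDatum Cover := GeoLocus.HeightDatum.ofCover coverModel L height

/-- Its height field is `height` (definitionally). -/
theorem displacementHeightDatum_h (L : Level) : (displacementHeightDatum L).h = height := rfl

/-- **(12.14.1) `HeightSubadditive` HOLDS** for the displacement height on the model. [folklore] -/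
theorem heightSubadditive_displacement (L : Level) : (displacementHeightDatum L).HeightSubadditive :=
  (GeoLocus.HeightDatum.heightSubadditive_ofCover_iff coverModel L height).mpr height_mul_le

/-- **(12.15.1) `HeightLogLinkBound` HOLDS** for the displacement height on the model (with equality). [folklore] -/
theorem heightLogLinkBound_displacement (L : Level) : (displacementHeightDatum L).HeightLogLinkBound :=
  (GeoLocus.HeightDatum.heightLogLinkBound_ofCover_iff coverModel L height).mpr fun g m => by
    rw [CoverSL2R.logLinkChain, height_mul_phi_zpow]

/-- E-t36's DERIVED Thm. 12.18.1 (OUR READING) for the displacement height: for every domain locus and every monodromy datum with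
`S ≠ ∅`. [folklore] -/
theorem thm12181Reading_displacement (L : Level) {Pi : Type} [Group Pi] {genus n : ℕ} (hn : 0 < n)
    (Lc : (displacementHeightDatum L).DomainLocus n) (M : GeoLocus.MonodromyDatum Pi genus n) :
    (displacementHeightDatum L).Thm12181Reading Lc M :=
  GeoLocus.HeightDatum.thm12181Reading_ofCover coverModel L height (heightSubadditive_displacement L) hn Lc M

/-- **JOINT SATISFIABILITY of E-t36's typed §12.14–12.15 hypotheses on an honest `S̃L₂(ℝ)`-model by a NON-TRIVIAL height**:
some `HeightDatum` over the model satisfies (12.14.1) AND (12.15.1), with `h(φ_∞) = π` and `h(1) = 0` (so `h` is not constant and the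
log-link slope is the printed `π`). A satisfiability witness, nothing more. [folklore] -/
theorem heightHypotheses_jointly_satisfiable (L : Level) :
    ∃ G : GeoLocus.HeightDatum Cover,
      G.lstar = L.lstar ∧ G.HeightSubadditive ∧ G.HeightLogLinkBound ∧ G.h coverModel.phi = π ∧ G.h 1 = 0 :=
  ⟨displacementHeightDatum L, rfl, heightSubadditive_displacement L, heightLogLinkBound_displacement L,
    by rw [displacementHeightDatum_h, height_phi], by rw [displacementHeightDatum_h, height_one]⟩

end CoverModel

end Summit.ABC.IUTFork.Joshi.ATS3.Geo

end

/-! ## 4. APPEND (RQ7 INFO I1 of w5-d070, 09:37:13Z): the SIGN of the height is forced by (12.15.1) as typed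

The displacement height is SIGNED (`height (z⁻¹) = −π/2`), while a translation-LENGTH is `≥ 0`. This is not an artefact of the
witness: for ANY `GeoLocus.HeightDatum` (E-t36, p430006), the typed (12.15.1) `HeightLogLinkBound : ∀ g (m : ℤ), h (g·φ_∞^m) ≤
h g + π·m` — print: «for `m ∈ ℤ`» (p.155 l.9) — applied at `g = 1`, `m = −k` gives `h(φ_∞^{−k}) ≤ h(1) − kπ → −∞`, so NO height
bounded below (in particular no height `≥ 0`) satisfies it (`not_heightLogLinkBound_of_bddBelow`). Whether [Zhang 2001]'s `ℓ` is
signed (a translation NUMBER) or the printed `m ∈ ℤ` should read `m ≥ 0` is a LANE question (E-ref), recorded here as a kernel fact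
about the typed sentence; no side taken. -/

namespace Summit.ABC.IUTFork.Joshi.ATS3

open scoped Real

/-- The displacement height is SIGNED: `height (z⁻¹) = −π/2`. [folklore] -/
theorem Geo.CoverModel.height_z_inv : Geo.CoverModel.height Geo.CoverModel.z⁻¹ = -(π / 2) := by
  rw [← zpow_neg_one, Geo.CoverModel.height_z_zpow]; push_cast; ring

/-- Along the negative log-link direction the displacement height is unbounded BELOW: `height (φ_∞^{−k}) = −kπ`. [folklore] -/
theorem Geo.CoverModel.height_phi_zpow_neg (k : ℕ) :
    Geo.CoverModel.height (Geo.coverModel.phi ^ (-(k : ℤ))) = -(k * π) := by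
  have h := Geo.CoverModel.height_mul_phi_zpow 1 (-(k : ℤ))
  rw [one_mul, Geo.CoverModel.height_one] at h
  rw [h]; push_cast; ring

/-- **(12.15.1) AS TYPED forces a height unbounded below.** For ANY `HeightDatum` (E-t36's §§12.9–12.18 signature), if
`HeightLogLinkBound` holds (all `m : ℤ`, as printed p.155 l.9 «for `m ∈ ℤ`»), then `h` takes values below every bound along
`φ_∞^{−k}` — so no height bounded below, in particular no NON-NEGATIVE height (a «length»), satisfies the typed (12.15.1). A kernel
fact about the typed sentence (LANE question for E-ref: signed translation number vs. `m ≥ 0`); no side taken. [folklore] -/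
theorem GeoLocus.HeightDatum.exists_h_lt_of_heightLogLinkBound {Y : Type} [Group Y] (G : GeoLocus.HeightDatum Y)
    (hB : G.HeightLogLinkBound) (B : ℝ) : ∃ m : ℤ, G.h (1 * G.frob ^ m) < B := by
  obtain ⟨n, hn⟩ := exists_nat_gt ((G.h 1 - B) / Real.pi)
  refine ⟨-(n : ℤ), lt_of_le_of_lt (hB 1 (-(n : ℤ))) ?_⟩
  have hπ := Real.pi_pos
  rw [div_lt_iff₀ hπ] at hn
  push_cast
  nlinarith

/-- Hence: a height bounded below (e.g. `h ≥ 0`) never satisfies E-t36's typed (12.15.1). [folklore] -/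
theorem GeoLocus.HeightDatum.not_heightLogLinkBound_of_bddBelow {Y : Type} [Group Y] (G : GeoLocus.HeightDatum Y) {B : ℝ}
    (hbdd : ∀ g, B ≤ G.h g) : ¬G.HeightLogLinkBound := fun hB => by
  obtain ⟨m, hm⟩ := G.exists_h_lt_of_heightLogLinkBound hB B
  exact absurd (hbdd _) (not_le.mpr hm)

/-- In particular no NON-NEGATIVE height satisfies the typed (12.15.1). [folklore] -/
theorem GeoLocus.HeightDatum.not_heightLogLinkBound_of_nonneg {Y : Type} [Group Y] (G : GeoLocus.HeightDatum Y)
    (h0 : ∀ g, 0 ≤ G.h g) : ¬G.HeightLogLinkBound :=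
  G.not_heightLogLinkBound_of_bddBelow h0

end Summit.ABC.IUTFork.Joshi.ATS3

-- olean re-sync (comment-only enqueue re-land, abc-iut-E-t53 gen 2, 2026-08-26): declarations byte-identical to p435971.
-- Reason: gate farm reported «remote:incoherent:1:Summits.ABC.IUTFork.Joshi.GeometricCaseCoverModelDisplacement:mismatch» for a child file.
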